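import Summits.QuantumFields.YangMills.Theorems.UnitScaleTiltProp7CovBlockGaussIntCS
import Summits.QuantumFields.YangMills.Theorems.UnitScaleTiltProp7CovariantWeitzenbock
import HarnessLib

/-!
# Route `UnitScaleTilt`, crux K1 «MinimiserStabilityRegPr» (stmt-QuantumFields-19200), route-R E′ S3 K-form engine, row (P′) ∕ hXb — «INT-TRANSPORT»:
# the INT-PAIRING ∕ INT-CS identities of ✓ `Prop7CovBlockGaussIntPairing` ∕ ✓ `Prop7CovBlockGaussIntCS` for an ARBITRARY unitary site transport `T : Site P 0 → 𝔸ˣ` per block (not only the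
# centre-based axial comb): the interior Gauss defect paired with the centre value is `Σ_{int} ⟨D_V Ψ^T_m, B⟩`, `Ψ^T_m(z) := R(T z)⁻¹ m` — so px5's hXb letter (corner comb `w c r` composed
# with the centre→corner frame `gL c`) and routeR-w1's h-averaged offset combs are covered by the same two lines

Cell `ym3-torus`, width seat `ym3-torus-px15` (gen 3); fifth brick of the hXb-inhabitant lane («BLOCK-GAUSS» GO, ★ym-ust-19200-p1 g16 WORD 10 (2)).  THEOREMS ONLY (0 `def`, 0 `sorry`, 0 `instance`);
`--supports stmt-QuantumFields-19200`, count-neutral.  YM₃ on T³ is a ladder rung (R3), not the Clay problem; nothing here claims a stub, the crux, d = 4 or the mass gap.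

THE POINT.  ✓p681851 proved `⟨m, INT(y)⟩ = Σ_int⟨D_VΨ_m, B⟩` for `T_r := axialT V c_y x_r` by recognising the loop of (27).  The identity needs no loop at all: for ANY site transport `T` with
`T_r := T(x_r)`, the interior summand `R(T_r)(R(T_r⁻¹T_{r+e_μ}V(b)⁻¹)X − X) = R(T(x_r+e_μ)·V(b)⁻¹)X − R(T(x_r))X`, and moving the two unitaries across the trace gives
`⟨R(V(b))Ψ^T_m(x_r+e_μ) − Ψ^T_m(x_r), X⟩ = ⟨(D_{V,μ}Ψ^T_m)(x_r), X⟩`.  Hence every comb family the knit prefers (px5's `gL c·w c r`, routeR-w1's offset combs, their `h`-averages identity by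
identity) books the interior part of the Gauss composite by ITS Dirichlet energy on the blocks' interior bonds.

WHAT IS PROVED (ns `…Theorems.Prop7CovBlockGaussIntTransport`; `M_N(ℂ)`, `V` unitary-valued, `T : Site P 0 → (M_N ℂ)ˣ` unitary-valued).
* §1 `re_trace_mul_R` (`Re tr(mᴴ·R(u)X) = Re tr((R(u⁻¹)m)ᴴ·X)`), `int_summand_eq_sub` (ring identity).
* §2 ★★★ `re_trace_int_summand_eq_covD_pairing_of_transport` (one interior bond), ★★★ `re_trace_int_eq_sum_covD_pairing_of_transport` (the block, `INT^T(y)` = ✓p680339's interior term at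
  `T_r := T(x_r)` VERBATIM), ★★★ `two_mul_abs_int_pairing_le_of_transport` (per-block transports `T_y`, centre values `φ_c`, `θ, ℓ > 0`:
  `2|Σ_y⟨φ_c y, INT^{T_y}(y)⟩| ≤ θ⁻¹ℓ·Σ_yΣ_μΣ_{int}|D_{V,μ}Ψ^{T_y}_{φ_c y}(x_r)|²_HS + θℓ⁻¹·Σ_xΣ_μ|B_μ(x)|²_HS`).
HONEST SCOPE.  Exact algebra + the weighted Cauchy–Schwarz of ✓p682982; no estimate of `D_VΨ^T` (displayed DIR-type row of the chosen family); `J_VH` and the face piece elsewhere.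

References: T. Bałaban, CMP 99 (1985) 389–434 [Balaban1985BackgroundPropagators] ((3.3)–(3.5) pp.390–391, (3.8) p.392); CMP 95 (1984) 17–40 [Balaban1984PropagatorsI] ((1.18)–(1.21) pp.20–21);
CMP 98 (1985) 17–51 [Balaban1985Averaging] ((8)–(9) pp.18–19); CMP 102 (1985) 277–309 [Balaban1985Variational] ((135) p.298, Prop. 7 p.299).
-/

set_option autoImplicit false

noncomputable section

open scoped BigOperators Matrix

namespace Summit.QuantumFields.YangMills.Theorems.Prop7CovBlockGaussIntTransport

open Literature.MathematicalPhysics.QuantumFieldTheory.Balaban1983to89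
open Finset
open B9Eq39Adjoint (R R_mul_R covD)
open B9TorusCalculus (torusT torusT_apply)
open B7Prop2Explicit (unitaryUnits mem_unitaryUnits)
open Summit.QuantumFields.YangMills.Theorems.Prop7CovariantCoercivity (coe_inv_eq_star conjTranspose_R inv_mem_unitary)
open Summit.QuantumFields.YangMills.Theorems.Prop7CovBlockGaussIntPairing (fibreSite_succ_eq_shift)
open Summit.QuantumFields.YangMills.Theorems.Prop7CovBlockGaussIntCS (two_mul_abs_sum_re_trace_le two_mul_abs_sum_sum_sum_le sum_interior_hs_le_mass)

variable {N : ℕ}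

/-! ## §1 Unitary bookkeeping -/

/-- For unitary `u`: `Re tr(mᴴ·R(u)X) = Re tr((R(u⁻¹)m)ᴴ·X)` (trace cyclicity ✓ `B9Eq39Adjoint.trace_R_mul` + ✓ `conjTranspose_R`). [folklore] -/
theorem re_trace_mul_R {u : (Matrix (Fin N) (Fin N) ℂ)ˣ} (hu : (u : Matrix (Fin N) (Fin N) ℂ) ∈ unitary (Matrix (Fin N) (Fin N) ℂ))
    (m X : Matrix (Fin N) (Fin N) ℂ) :
    ((mᴴ * R u X).trace).re = (((R u⁻¹ m)ᴴ * X).trace).re := by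
  have hcyc : (R u⁻¹ mᴴ * X).trace = (mᴴ * R (u⁻¹)⁻¹ X).trace :=
    B9Eq39Adjoint.trace_R_mul (Matrix.traceAddMonoidHom (Fin N) ℂ) (fun a b => Matrix.trace_mul_comm a b) u⁻¹ mᴴ X
  rw [inv_inv] at hcyc
  rw [conjTranspose_R (inv_mem_unitary hu), hcyc]

/-- Ring identity: `R(T)(R(T⁻¹·T′·V⁻¹)X − X) = R(T′·V⁻¹)X − R(T)X`. [folklore] -/
theorem int_summand_eq_sub {𝔸 : Type*} [Ring 𝔸] (T T' V : 𝔸ˣ) (X : 𝔸) :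
    R T (R (T⁻¹ * T' * V⁻¹) X - X) = R (T' * V⁻¹) X - R T X := by
  rw [B9Eq39Adjoint.R_sub, ← B9Eq39Adjoint.R_mul]
  congr 2
  group

/-! ## §2 The interior Gauss defect paired with the centre value, for an arbitrary unitary site transport -/

section Transport

variable {P : Params} {k : ℕ} (h : P.sitesPerDir 0 = P.L ^ k * P.sitesPerDir k)
  {V : GaugeField P 0 (Matrix (Fin N) (Fin N) ℂ)ˣ} (hV : ∀ b, V b ∈ unitaryUnits (Matrix (Fin N) (Fin N) ℂ))

include hV in
/-- ★★★ **ONE INTERIOR BOND, ANY UNITARY SITE TRANSPORT `T`**: with `T_r := T(x_r)` and `Ψ^T_m(z) := R(T z)⁻¹ m`, for an interior bond `(x_r, x_r + e_μ)` of `B(y)`: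
`Re tr(mᴴ·R(T_r)(R(T_r⁻¹·T_{r+e_μ}·V(b)⁻¹)X − X)) = Re tr((D_{V,μ}Ψ^T_m(x_r))ᴴ·X)`. [cite: Balaban1985BackgroundPropagators, (3.3) p.390, (3.5) p.391] -/
theorem re_trace_int_summand_eq_covD_pairing_of_transport (T : Site P 0 → (Matrix (Fin N) (Fin N) ℂ)ˣ)
    (hT : ∀ x, (T x : Matrix (Fin N) (Fin N) ℂ) ∈ unitary (Matrix (Fin N) (Fin N) ℂ))
    (y : Site P k) (r : Fin P.d → Fin (P.L ^ k)) (μ : Fin P.d) (hr : (r μ : ℕ) + 1 < P.L ^ k) (m X : Matrix (Fin N) (Fin N) ℂ) :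
    ((mᴴ * (R (T (Site.fibreSite 0 k y r))
        (R ((T (Site.fibreSite 0 k y r))⁻¹
              * T (Site.fibreSite 0 k y (Function.update r μ ⟨min ((r μ : ℕ) + 1) (P.L ^ k - 1), by have := (r μ).isLt; omega⟩))
              * (V ⟨Site.fibreSite 0 k y r, μ⟩)⁻¹) X - X))).trace).re
      = (((covD (torusT P 0) (fun κ z => V ⟨z, κ⟩) μ (fun z => R (T z)⁻¹ m) (Site.fibreSite 0 k y r))ᴴ * X).trace).re := by
  set x := Site.fibreSite 0 k y r with hx
  have hVu : ((V ⟨x, μ⟩ : (Matrix (Fin N) (Fin N) ℂ)ˣ) : Matrix (Fin N) (Fin N) ℂ) ∈ unitary (Matrix (Fin N) (Fin N) ℂ) := mem_unitaryUnits.mp (hV _)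
  rw [fibreSite_succ_eq_shift y r μ hr, int_summand_eq_sub, Matrix.mul_sub, Matrix.trace_sub, Complex.sub_re]
  have hA : ((T (x.shift μ) * (V ⟨x, μ⟩)⁻¹ : (Matrix (Fin N) (Fin N) ℂ)ˣ) : Matrix (Fin N) (Fin N) ℂ) ∈ unitary (Matrix (Fin N) (Fin N) ℂ) := by
    rw [Units.val_mul]
    exact Submonoid.mul_mem _ (hT _) (inv_mem_unitary hVu)
  rw [re_trace_mul_R hA, re_trace_mul_R (hT x), ← Complex.sub_re, ← Matrix.trace_sub, ← Matrix.sub_mul, ← Matrix.conjTranspose_sub]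
  -- `R((T⁺V⁻¹)⁻¹)m − R(T⁻¹)m = R(V)Ψ(x+e_μ) − Ψ(x) = (D_VΨ)(x,μ)`
  congr 4
  rw [mul_inv_rev, inv_inv, B9Eq39Adjoint.R_mul]
  rfl

include hV in
/-- ★★★ **THE BLOCK, ANY UNITARY SITE TRANSPORT**: `Re tr(mᴴ·INT^T(y)) = Σ_μ Σ_{r_μ+1<L^k} Re tr((D_{V,μ}Ψ^T_m(x_r))ᴴ·B_μ(x_r))`, `INT^T(y)` = the interior term of ✓ `block_sum_R_divB_eq` at `T_r := T(x_r)`.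
[cite: Balaban1985BackgroundPropagators, (3.3)-(3.5) pp.390-391, (3.8) p.392; Balaban1984PropagatorsI, (1.21) p.21] -/
theorem re_trace_int_eq_sum_covD_pairing_of_transport (T : Site P 0 → (Matrix (Fin N) (Fin N) ℂ)ˣ)
    (hT : ∀ x, (T x : Matrix (Fin N) (Fin N) ℂ) ∈ unitary (Matrix (Fin N) (Fin N) ℂ))
    (y : Site P k) (B : Fin P.d → Site P 0 → Matrix (Fin N) (Fin N) ℂ) (m : Matrix (Fin N) (Fin N) ℂ) :
    ((mᴴ * ∑ μ : Fin P.d, ∑ r ∈ univ.filter (fun r : Fin P.d → Fin (P.L ^ k) => (r μ : ℕ) + 1 < P.L ^ k),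
        R (T (Site.fibreSite 0 k y r))
          (R ((T (Site.fibreSite 0 k y r))⁻¹
                * T (Site.fibreSite 0 k y (Function.update r μ ⟨min ((r μ : ℕ) + 1) (P.L ^ k - 1), by have := (r μ).isLt; omega⟩))
                * (V ⟨Site.fibreSite 0 k y r, μ⟩)⁻¹) (B μ (Site.fibreSite 0 k y r)) - B μ (Site.fibreSite 0 k y r))).trace).re
      = ∑ μ : Fin P.d, ∑ r ∈ univ.filter (fun r : Fin P.d → Fin (P.L ^ k) => (r μ : ℕ) + 1 < P.L ^ k),
          (((covD (torusT P 0) (fun κ z => V ⟨z, κ⟩) μ (fun z => R (T z)⁻¹ m) (Site.fibreSite 0 k y r))ᴴ * B μ (Site.fibreSite 0 k y r)).trace).re := by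
  rw [Matrix.mul_sum, Matrix.trace_sum, Complex.re_sum]
  refine Finset.sum_congr rfl fun μ _ => ?_
  rw [Matrix.mul_sum, Matrix.trace_sum, Complex.re_sum]
  refine Finset.sum_congr rfl fun r hr => ?_
  exact re_trace_int_summand_eq_covD_pairing_of_transport hV T hT y r μ (Finset.mem_filter.mp hr).2 m _

include h hV in
/-- ★★★ **INT-CS FOR ANY FAMILY OF UNITARY SITE TRANSPORTS `T_y`** (one per block), centre values `φ_c`, any `B`, any `θ, ℓ > 0`:
`2·|Σ_y Re tr((φ_c y)ᴴ·INT^{T_y}(y))| ≤ θ⁻¹·ℓ·Σ_yΣ_μΣ_{r_μ+1<L^k} |D_{V,μ}Ψ^{T_y}_{φ_c y}(x_r)|²_HS + θ·ℓ⁻¹·Σ_xΣ_μ |B_μ(x)|²_HS`.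
[cite: Balaban1985Variational, (135) p.298, Prop. 7 p.299; Balaban1985BackgroundPropagators, (3.3)-(3.5) pp.390-391] -/
theorem two_mul_abs_int_pairing_le_of_transport (T : Site P k → Site P 0 → (Matrix (Fin N) (Fin N) ℂ)ˣ)
    (hT : ∀ y x, (T y x : Matrix (Fin N) (Fin N) ℂ) ∈ unitary (Matrix (Fin N) (Fin N) ℂ)) {θ ℓ : ℝ} (hθ : 0 < θ) (hℓ : 0 < ℓ)
    (φc : Site P k → Matrix (Fin N) (Fin N) ℂ) (B : Fin P.d → Site P 0 → Matrix (Fin N) (Fin N) ℂ) :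
    2 * |∑ y : Site P k, (((φc y)ᴴ * ∑ μ : Fin P.d, ∑ r ∈ univ.filter (fun r : Fin P.d → Fin (P.L ^ k) => (r μ : ℕ) + 1 < P.L ^ k),
        R (T y (Site.fibreSite 0 k y r))
          (R ((T y (Site.fibreSite 0 k y r))⁻¹
                * T y (Site.fibreSite 0 k y (Function.update r μ ⟨min ((r μ : ℕ) + 1) (P.L ^ k - 1), by have := (r μ).isLt; omega⟩))
                * (V ⟨Site.fibreSite 0 k y r, μ⟩)⁻¹) (B μ (Site.fibreSite 0 k y r)) - B μ (Site.fibreSite 0 k y r))).trace).re|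
      ≤ θ⁻¹ * ℓ * ∑ y : Site P k, ∑ μ : Fin P.d, ∑ r ∈ univ.filter (fun r : Fin P.d → Fin (P.L ^ k) => (r μ : ℕ) + 1 < P.L ^ k),
            ∑ j : Fin N, ∑ l : Fin N, ‖(covD (torusT P 0) (fun κ z => V ⟨z, κ⟩) μ (fun z => R (T y z)⁻¹ (φc y)) (Site.fibreSite 0 k y r)) j l‖ ^ 2
        + θ * ℓ⁻¹ * ∑ x : Site P 0, ∑ μ : Fin P.d, ∑ j : Fin N, ∑ l : Fin N, ‖B μ x j l‖ ^ 2 := by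
  have hθ' : 0 < θ⁻¹ * ℓ := mul_pos (inv_pos.mpr hθ) hℓ
  have hinv : (θ⁻¹ * ℓ)⁻¹ = θ * ℓ⁻¹ := by rw [mul_inv, inv_inv]
  rw [Finset.sum_congr rfl fun y _ => re_trace_int_eq_sum_covD_pairing_of_transport hV (T y) (hT y) y B (φc y)]
  have hb := two_mul_abs_sum_sum_sum_le (Finset.univ : Finset (Site P k)) (Finset.univ : Finset (Fin P.d))
    (fun μ => univ.filter (fun r : Fin P.d → Fin (P.L ^ k) => (r μ : ℕ) + 1 < P.L ^ k))
    (fun y μ r => (((covD (torusT P 0) (fun κ z => V ⟨z, κ⟩) μ (fun z => R (T y z)⁻¹ (φc y)) (Site.fibreSite 0 k y r))ᴴ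
              * B μ (Site.fibreSite 0 k y r)).trace).re)
    (fun y μ r => ∑ j : Fin N, ∑ l : Fin N, ‖(covD (torusT P 0) (fun κ z => V ⟨z, κ⟩) μ (fun z => R (T y z)⁻¹ (φc y)) (Site.fibreSite 0 k y r)) j l‖ ^ 2)
    (fun y μ r => ∑ j : Fin N, ∑ l : Fin N, ‖B μ (Site.fibreSite 0 k y r) j l‖ ^ 2)
    (t := θ⁻¹ * ℓ) (fun y _ μ _ => two_mul_abs_sum_re_trace_le _ hθ' _ _)
  refine hb.trans (add_le_add le_rfl ?_)
  rw [hinv]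
  exact mul_le_mul_of_nonneg_left (sum_interior_hs_le_mass h B) (by positivity)

end Transport

end Summit.QuantumFields.YangMills.Theorems.Prop7CovBlockGaussIntTransport

end
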